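import Mathlib

/-!
# Independence modulo a prime implies independence over ℤ and ℚ (design-certificate helper)

Second piece of the *duality certificate* infrastructure for level-one separated designs (cell
dossier `SUBFIELD.md` §10.5): the rank bound `rank_ℚ A ≥ rank_{𝔽_p} (A mod p)` in the form
"integer vectors whose reductions mod `p` are linearly independent over `ZMod p` are linearly
independent over `ℤ` and over `ℚ`".  With a verified elimination mod a good prime `p` this turns the
rank hypothesis of `exists_mulVec_eq_of_leftKernel` into a finite computation.  Pure algebra;
certificate infrastructure, NOT summit progress.
-/

namespace Summit.MatrixMultiplication.MatrixMultiplication.Theorems.GradedDesignFamily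

/-- Integer vectors that are linearly independent modulo a prime `p` are linearly independent over `ℤ`
(a primitive integer relation would reduce to a non-trivial relation mod `p`). -/
theorem linearIndependent_int_of_zmod {m ι : Type*} [Fintype m] [Fintype ι] {p : ℕ} [hp : Fact p.Prime]
    (w : ι → m → ℤ) (h : LinearIndependent (ZMod p) (fun i j => ((w i j : ℤ) : ZMod p))) :
    LinearIndependent ℤ w := by
  classical
  rw [Fintype.linearIndependent_iff] at h ⊢
  intro a ha
  by_contra hne
  obtain ⟨i₀, hi₀⟩ := not_forall.mp hne
  obtain ⟨a', ha', hg⟩ := Finset.extract_gcd a ⟨i₀, Finset.mem_univ _⟩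
  set g := Finset.univ.gcd a with hgdef
  have hg0 : g ≠ 0 := by
    intro h0
    exact hi₀ ((Finset.gcd_eq_zero_iff.mp h0) i₀ (Finset.mem_univ _))
  have ha'rel : ∑ i, a' i • w i = 0 := by
    have hga : g • ∑ i, a' i • w i = ∑ i, a i • w i := by
      rw [Finset.smul_sum]
      refine Finset.sum_congr rfl fun i _ => ?_
      rw [smul_smul, ← ha' i (Finset.mem_univ _)]
    have : g • ∑ i, a' i • w i = 0 := by rw [hga, ha]
    exact (smul_eq_zero.mp this).resolve_left hg0
  have hnd : ∃ i, ¬ (p : ℤ) ∣ a' i := by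
    by_contra hall
    have hall' : ∀ i, (p : ℤ) ∣ a' i := fun i => by
      by_contra hi
      exact hall ⟨i, hi⟩
    have hdvd : (p : ℤ) ∣ Finset.univ.gcd a' := Finset.dvd_gcd fun i _ => hall' i
    rw [hg] at hdvd
    have hp1 : 1 < p := hp.out.one_lt
    have := Int.le_of_dvd one_pos hdvd
    omega
  obtain ⟨i₁, hi₁⟩ := hnd
  have hmod : ∑ i, ((a' i : ℤ) : ZMod p) • (fun j => ((w i j : ℤ) : ZMod p)) = 0 := by
    ext j
    have hj := congr_fun ha'rel j
    simp only [Finset.sum_apply, Pi.smul_apply, smul_eq_mul, Pi.zero_apply] at hj ⊢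
    have := congrArg (Int.cast : ℤ → ZMod p) hj
    push_cast at this
    exact this
  have hz := h (fun i => (a' i : ZMod p)) hmod i₁
  exact hi₁ ((ZMod.intCast_zmod_eq_zero_iff_dvd (a' i₁) p).mp hz)

/-- … and hence linearly independent over `ℚ` (as rational vectors). -/
theorem linearIndependent_rat_of_zmod {m ι : Type*} [Fintype m] [Fintype ι] {p : ℕ} [Fact p.Prime]
    (w : ι → m → ℤ) (h : LinearIndependent (ZMod p) (fun i j => ((w i j : ℤ) : ZMod p))) :
    LinearIndependent ℚ (fun i j => ((w i j : ℤ) : ℚ)) := by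
  classical
  have hZ := linearIndependent_int_of_zmod w h
  let f : (m → ℤ) →ₗ[ℤ] (m → ℚ) :=
    { toFun := fun v j => (v j : ℚ)
      map_add' := fun u v => by ext j; simp
      map_smul' := fun c v => by ext j; simp }
  have hf : LinearMap.ker f = ⊥ := by
    rw [LinearMap.ker_eq_bot']
    intro v hv
    ext j
    have := congr_fun hv j
    simpa [f] using this
  have hZ' : LinearIndependent ℤ (f ∘ w) := hZ.map' f hf
  have hZ'' : LinearIndependent ℤ (fun i j => ((w i j : ℤ) : ℚ)) := by
    have hfw : (fun i j => ((w i j : ℤ) : ℚ)) = f ∘ w := by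
      funext i
      rfl
    rw [hfw]
    exact hZ'
  exact (LinearIndependent.iff_fractionRing ℤ ℚ).mp hZ''

end Summit.MatrixMultiplication.MatrixMultiplication.Theorems.GradedDesignFamily
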